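import Literature.NumberTheory.EllipticCurves.BhargavaShankarSolubleOrbits
import HarnessLib

/-!
# An explicit `2`-descent for binary quartic forms over any field with `6 ≠ 0`:
# the chord identities behind `f_P ∼ f_Q ⇒ P − Q ∈ 2E(K)` (Bhargava–Shankar, Lemma 5.10)

`Proofs` companion (theorems only: no definitions, no named facts) of `BinaryQuarticForms.lean`,
`BinaryQuarticStabilizer.lean` (the twisted action `γ · f = (det γ)⁻² f((x,y)γ)`, the quartic
covariant `g₄`) and `BinaryQuarticCovariants.lean` (the sextic covariant `g₆`, the syzygy).

Source. M. Bhargava, A. Shankar, *Binary quartic forms having bounded invariants, and the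
boundedness of the average rank of elliptic curves*, Ann. of Math. (2) 181 (2015) 191–242, §5.2 of
the held arXiv text `arXiv:1006.1002v2`, **Lemma 5.10** (= Thm 3.2 of the published version): the
map `E(K)/2E(K) → {K-classes of quartics with invariants I, J}` "is injective and the image
consists exactly of the `K`-soluble classes". The companion files `BhargavaShankarSolubleOrbits`,
`BhargavaShankarTrivialClass` treat the normal forms and the identity class *in characteristic
zero* (their covering map `coveringX/Y` carries `[CharZero K]`). For the finite-field and `p`-adic
applications (`BinaryQuarticFiniteFieldSolubilityProofs.lean`: every quartic with `Δ ≠ 0` over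
`𝔽_q`, `q` prime to `6`, is soluble — the genus-one input of Prop. 5.13 of the arXiv text =
Prop. 3.18 of the published version) one needs the *injectivity* half over an arbitrary field with
`2 ≠ 0`, `3 ≠ 0`, which this file supplies through completely explicit chord computations on the
integral model (Cremona, *Classical invariants and 2-descent on elliptic curves*, J. Symbolic
Comput. 31 (2001), §4)

  `E'_{I,J} : Y² = X³ − 27 I X − 27 J`.

For a **monic depressed** form `f = x⁴ + c x²y² + d xy³ + e y⁴` (every form with `a ≠ 0` is a
shear of `a` times one) with invariants `I = I(f)`, `J = J(f)`:

* `Q'_f = (−6c, 27d) ∈ E'_{I,J}(K)` (`basePoint_equation`) — the image of the base point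
  `(1 : 0 : 1)` of `C_f : z² = f(x,y)` under the `2`-covering map
  `(x : y : z) ↦ (3g₄(x,y)/(4z²), 27g₆(x,y)/(8z³))` (`covering_equation`; Cremona 2001, Prop. 4.2);
* for a point `(u, v)` of `z² = f(x, 1)` the two points
  `Θ(u, ±v) = (±18v + 18u² + 3c, ±108uv + 108u³ + 54cu + 27d)` lie on `E'_{I,J}`
  (`descentPoint_equation`: the classical transformation of `v² = u⁴ + cu² + du + e` to Weierstrass
  form by `X = 18(v + u²) + 3c`), and, for `v ≠ 0`, **by two chord computations with distinct
  abscissae** (`x₁ − x₂ = 36v`):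
  - `Θ(u, v) + Θ(u, −v) = −Q'_f` (`descentPoint_add_conj`, slope `6u`),
  - `Θ(u, v) − Θ(u, −v) = (3g₄(u,1)/(4v²), 27g₆(u,1)/(8v³))` (`descentPoint_add_neg_conj`, slope
    `3f'(u)/(2v)`, using `g₄(u,1) = 3f'² − 4ff''`, `27g₆(u,1) = 54ff'f'' − 27f'³ − 36f²f'''`),
  whence the covering image of `(u : 1 : v)` is `Q'_f + 2Θ(u,v)` (Cremona 2001, Prop. 4.3 (4): the
  image of `C_f(K)` is a coset of `2E(K)`);
* at a root (`v = 0`, then `f'(u) ≠ 0` when `4I³ ≠ J²`, `four_I_cube_sub_J_sq_eq_zero_of_double_root`):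
  `2 · (18u² + 3c, 27f'(u)) = −Q'_f` (`rootPoint_add_self`).

Consequences for the twisted action (`γ · f = f'` transports the base point of `C_{f'}` to a point
of `C_f` with the same covering image, by the covariance of `g₄`, `g₆`):

* `exists_basePoint_sub_eq_add_self`: if `f`, `f'` are monic depressed with the same invariants
  and `γ · f = f'`, then `Q'_{f'} − Q'_f ∈ 2E'_{I,J}(K)`;
* `exists_basePoint_eq_add_self_of_twist_a_eq_zero`: if `γ · f` has `a = 0` (the class of `f`
  contains `y · (cubic)`, i.e. `f` has a `K`-rational linear factor), then `Q'_f ∈ 2E'_{I,J}(K)`.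

All identities are closed by `linear_combination` with explicit integer certificates.

## References

* M. Bhargava, A. Shankar, Ann. of Math. (2) 181 (2015) 191–242, Lemma 5.10 (arXiv:1006.1002v2
  numbering; Thm 3.2 of the published version). [cite: BhargavaShankarAnnals2015, Lemma 5.10 (arXiv:1006.1002v2 numbering)]
* J. E. Cremona, *Classical invariants and 2-descent on elliptic curves*, J. Symbolic Comput. 31
  (2001) 71–87, Prop. 4.2 (the covering map to `Y² = X³ − 27IX − 27J`), Prop. 4.3 (4).
  [cite: Cremona2001, Prop. 4.2–4.3]
-/

noncomputable section

open scoped Classical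

namespace Literature.NumberTheory.EllipticCurves

namespace BinaryQuartic

variable {K : Type*} [Field K]

/-! ## The integral model `E'_{I,J} : Y² = X³ − 27IX − 27J` -/

/-- The affine equation of `E'_{I,J}`, multiplied out. [cite: Cremona2001, §4 (E_{I,J})] -/
theorem cremona_equation_iff (I J x y : K) :
    (⟨0, 0, 0, -27 * I, -27 * J⟩ : WeierstrassCurve K).toAffine.Equation x y ↔
      y ^ 2 = x ^ 3 - 27 * I * x - 27 * J := by
  rw [WeierstrassCurve.Affine.equation_iff]
  constructor <;> intro h <;> linear_combination h

/-- The discriminant of `E'_{I,J}` is `16 · 27³ · (4I³ − J²)`. [cite: Cremona2001, §4 (E_{I,J})] -/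
theorem cremona_Δ (I J : K) :
    (⟨0, 0, 0, -27 * I, -27 * J⟩ : WeierstrassCurve K).Δ = 16 * 27 ^ 3 * (4 * I ^ 3 - J ^ 2) := by
  simp only [WeierstrassCurve.Δ, WeierstrassCurve.b₂, WeierstrassCurve.b₄, WeierstrassCurve.b₆,
    WeierstrassCurve.b₈]
  ring

/-- `E'_{I,J}` is an elliptic curve when `4I³ ≠ J²` and `2, 3 ≠ 0`. [cite: Cremona2001, §4 (E_{I,J})] -/
theorem cremona_isElliptic (h2 : (2 : K) ≠ 0) (h3 : (3 : K) ≠ 0) {I J : K}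
    (hIJ : 4 * I ^ 3 - J ^ 2 ≠ 0) :
    (⟨0, 0, 0, -27 * I, -27 * J⟩ : WeierstrassCurve K).IsElliptic := by
  rw [WeierstrassCurve.isElliptic_iff, cremona_Δ]
  have h16 : (16 : K) ≠ 0 := by
    rw [show (16 : K) = 2 * 2 * 2 * 2 by norm_num]
    exact mul_ne_zero (mul_ne_zero (mul_ne_zero h2 h2) h2) h2
  have h27 : (27 : K) ≠ 0 := by
    rw [show (27 : K) = 3 * 3 * 3 by norm_num]; exact mul_ne_zero (mul_ne_zero h3 h3) h3
  exact (mul_ne_zero (mul_ne_zero h16 (pow_ne_zero _ h27)) hIJ).isUnit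

/-- On `E'_{I,J}` (`4I³ ≠ J²`) every point on the curve is nonsingular. [cite: Cremona2001, §4 (E_{I,J})] -/
theorem cremona_nonsingular (h2 : (2 : K) ≠ 0) (h3 : (3 : K) ≠ 0) {I J : K}
    (hIJ : 4 * I ^ 3 - J ^ 2 ≠ 0) {x y : K}
    (h : (⟨0, 0, 0, -27 * I, -27 * J⟩ : WeierstrassCurve K).toAffine.Equation x y) :
    (⟨0, 0, 0, -27 * I, -27 * J⟩ : WeierstrassCurve K).toAffine.Nonsingular x y := by
  haveI := cremona_isElliptic h2 h3 hIJ
  exact WeierstrassCurve.Affine.equation_iff_nonsingular.mp h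

/-- Negation on `E'_{I,J}` is `(x, y) ↦ (x, −y)`. [folklore] -/
theorem cremona_negY (I J x y : K) :
    (⟨0, 0, 0, -27 * I, -27 * J⟩ : WeierstrassCurve K).toAffine.negY x y = -y := by
  simp [WeierstrassCurve.Affine.negY]

/-- `27Δ(f) = 4I³ − J²`: nondegenerate invariants from `Δ(f) ≠ 0`. [cite: BhargavaShankarAnnals2015, §2 (Δ = (4I³ − J²)/27)] -/
theorem four_I_cube_sub_J_sq_ne_zero {f : BinaryQuartic K} (hΔ : f.disc ≠ 0) (h3 : (3 : K) ≠ 0) :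
    4 * f.I ^ 3 - f.J ^ 2 ≠ 0 := by
  rw [← twentySeven_mul_disc]
  have h27 : (27 : K) ≠ 0 := by
    rw [show (27 : K) = 3 * 3 * 3 by norm_num]; exact mul_ne_zero (mul_ne_zero h3 h3) h3
  exact mul_ne_zero h27 hΔ

/-! ## The covering map `(x : y : z) ↦ (3g₄/(4z²), 27g₆/(8z³))` to `E'_{I(f),J(f)}` -/

/-- **The covering map lands on `E'_{I,J}`** (Cremona 2001, Prop. 4.2, integral model): if
`z² = f(x,y)` with `z ≠ 0` then `(3g₄(x,y)/(4z²), 27g₆(x,y)/(8z³)) ∈ E'_{I(f),J(f)}` — the syzygy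
`27g₆² = g₄³ − 48If²g₄ − 64Jf³` divided by `64z⁶/27`. [cite: Cremona2001, Prop. 4.2] -/
theorem covering_equation (h2 : (2 : K) ≠ 0) (f : BinaryQuartic K) {x y z : K}
    (hz : z ^ 2 = f.eval x y) (hz0 : z ≠ 0) :
    (⟨0, 0, 0, -27 * f.I, -27 * f.J⟩ : WeierstrassCurve K).toAffine.Equation
      (3 * (g4 f).eval x y / (4 * z ^ 2)) (27 * f.g6 x y / (8 * z ^ 3)) := by
  rw [cremona_equation_iff]
  have h4 : (4 : K) ≠ 0 := by rw [show (4 : K) = 2 * 2 by norm_num]; exact mul_ne_zero h2 h2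
  have h8 : (8 : K) ≠ 0 := by rw [show (8 : K) = 2 * 4 by norm_num]; exact mul_ne_zero h2 h4
  set X := 3 * (g4 f).eval x y / (4 * z ^ 2) with hXd
  set Y := 27 * f.g6 x y / (8 * z ^ 3) with hYd
  have hX : 4 * z ^ 2 * X = 3 * (g4 f).eval x y := by
    rw [hXd]; field_simp
  have hY : 8 * z ^ 3 * Y = 27 * f.g6 x y := by
    rw [hYd]; field_simp
  have h64 : (64 : K) * z ^ 6 ≠ 0 :=
    mul_ne_zero (by rw [show (64 : K) = 8 * 8 by norm_num]; exact mul_ne_zero h8 h8)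
      (pow_ne_zero _ hz0)
  have syz := syzygy f x y
  rw [← hz] at syz
  apply mul_left_cancel₀ h64
  linear_combination (8 * z ^ 3 * Y + 27 * f.g6 x y) * hY
    - (16 * z ^ 4 * X ^ 2 + 12 * z ^ 2 * X * (g4 f).eval x y + 9 * ((g4 f).eval x y) ^ 2) * hX
    + 432 * f.I * z ^ 4 * hX + 27 * syz

/-- The covering map is constant along the fibres of `(x, y, z) ↦ (x : y : z)` with weights
`(1, 1, 2)`: `x`-coordinate. [cite: Cremona2001, Prop. 4.2] -/
theorem coveringX'_smul (f : BinaryQuartic K) {t : K} (ht : t ≠ 0) (x y z : K) :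
    3 * (g4 f).eval (t * x) (t * y) / (4 * (t ^ 2 * z) ^ 2) = 3 * (g4 f).eval x y / (4 * z ^ 2) := by
  rw [g4_eval_smul_smul, show 4 * (t ^ 2 * z) ^ 2 = t ^ 4 * (4 * z ^ 2) by ring,
    show 3 * (t ^ 4 * (g4 f).eval x y) = t ^ 4 * (3 * (g4 f).eval x y) by ring,
    mul_div_mul_left _ _ (pow_ne_zero _ ht)]

/-- The covering map is constant along the fibres of `(x, y, z) ↦ (x : y : z)` with weights
`(1, 1, 2)`: `y`-coordinate. [cite: Cremona2001, Prop. 4.2] -/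
theorem coveringY'_smul (f : BinaryQuartic K) {t : K} (ht : t ≠ 0) (x y z : K) :
    27 * f.g6 (t * x) (t * y) / (8 * (t ^ 2 * z) ^ 3) = 27 * f.g6 x y / (8 * z ^ 3) := by
  rw [g6_smul_smul, show 8 * (t ^ 2 * z) ^ 3 = t ^ 6 * (8 * z ^ 3) by ring,
    show 27 * (t ^ 6 * f.g6 x y) = t ^ 6 * (27 * f.g6 x y) by ring,
    mul_div_mul_left _ _ (pow_ne_zero _ ht)]

/-- **Invariance of the covering map under the twisted action, at the base point**: the covering
image of the base point `(1 : 0 : 1)` of `C_{γ·f}` is the covering image of the point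
`(γ₀₀ : γ₀₁ : det γ)` of `C_f`, `x`-coordinate (covariance of `g₄`). [cite: Cremona2001, Prop. 4.2 (with §2: covariance of g₄)] -/
theorem coveringX'_twist_base {γ : Matrix (Fin 2) (Fin 2) K} (hγ : γ.det ≠ 0) (f : BinaryQuartic K) :
    3 * (g4 (twist γ f)).eval 1 0 / 4 = 3 * (g4 f).eval (γ 0 0) (γ 0 1) / (4 * γ.det ^ 2) := by
  rw [g4_twist_eval hγ]
  simp only [one_mul, zero_mul, add_zero]
  field_simp

/-- Invariance of the covering map under the twisted action at the base point, `y`-coordinate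
(covariance of `g₆`). [cite: Cremona2001, Prop. 4.2 (with §2: covariance of g₆)] -/
theorem coveringY'_twist_base {γ : Matrix (Fin 2) (Fin 2) K} (hγ : γ.det ≠ 0) (f : BinaryQuartic K) :
    27 * (twist γ f).g6 1 0 / 8 = 27 * f.g6 (γ 0 0) (γ 0 1) / (8 * γ.det ^ 3) := by
  rw [g6_twist hγ]
  simp only [one_mul, zero_mul, add_zero]
  field_simp

/-- For a monic depressed form the covering image of the base point `(1 : 0 : 1)` is
`Q'_f = (−6c, 27d)`: `x`-coordinate, `3g₄(1,0)/4 = 3(3b² − 8ac)/4 = −6c`. [cite: Cremona2001, Prop. 4.2] -/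
theorem coveringX'_base {f : BinaryQuartic K} (ha : f.a = 1) (hb : f.b = 0) (h2 : (2 : K) ≠ 0) :
    3 * (g4 f).eval 1 0 / 4 = -6 * f.c := by
  have h4 : (4 : K) ≠ 0 := by rw [show (4 : K) = 2 * 2 by norm_num]; exact mul_ne_zero h2 h2
  rw [g4_eval_one_zero, ha, hb, div_eq_iff h4]; ring

/-- For a monic depressed form the covering image of the base point is `Q'_f = (−6c, 27d)`:
`y`-coordinate, `27g₆(1,0)/8 = 27(b³ + 8a²d − 4abc)/8 = 27d`. [cite: Cremona2001, Prop. 4.2] -/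
theorem coveringY'_base {f : BinaryQuartic K} (ha : f.a = 1) (hb : f.b = 0) (h2 : (2 : K) ≠ 0) :
    27 * f.g6 1 0 / 8 = 27 * f.d := by
  have h4 : (4 : K) ≠ 0 := by rw [show (4 : K) = 2 * 2 by norm_num]; exact mul_ne_zero h2 h2
  have h8 : (8 : K) ≠ 0 := by rw [show (8 : K) = 2 * 4 by norm_num]; exact mul_ne_zero h2 h4
  rw [g6_one_zero, ha, hb, div_eq_iff h8]; ring

/-! ## The points `Q'_f` and `Θ(u, ±v)` on `E'_{I,J}` for a monic depressed form -/

/-- **`Q'_f = (−6c, 27d)` lies on `E'_{I(f),J(f)}`** for `f = x⁴ + cx²y² + dxy³ + ey⁴` (an identity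
in `c, d, e`). [cite: Cremona2001, Prop. 4.2] -/
theorem basePoint_equation {f : BinaryQuartic K} (ha : f.a = 1) (hb : f.b = 0) :
    (⟨0, 0, 0, -27 * f.I, -27 * f.J⟩ : WeierstrassCurve K).toAffine.Equation
      (-6 * f.c) (27 * f.d) := by
  rw [cremona_equation_iff]
  simp only [BinaryQuartic.I, BinaryQuartic.J, ha, hb]
  ring

/-- **The descent point `Θ(u, v) = (18v + 18u² + 3c, 108uv + 108u³ + 54cu + 27d)` lies on
`E'_{I,J}`** whenever `v² = f(u, 1)` (`f` monic depressed): the transformation of the quartic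
`v² = u⁴ + cu² + du + e` with its rational point at infinity to Weierstrass form. [folklore] -/
theorem descentPoint_equation {f : BinaryQuartic K} (ha : f.a = 1) (hb : f.b = 0) {u v : K}
    (hv : v ^ 2 = f.eval u 1) :
    (⟨0, 0, 0, -27 * f.I, -27 * f.J⟩ : WeierstrassCurve K).toAffine.Equation
      (18 * v + 18 * u ^ 2 + 3 * f.c) (108 * u * v + 108 * u ^ 3 + 54 * f.c * u + 27 * f.d) := by
  rw [cremona_equation_iff]
  simp only [BinaryQuartic.I, BinaryQuartic.J, eval, ha, hb] at hv ⊢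
  linear_combination (-5832 * u ^ 2 - 5832 * v - 2916 * f.c) * hv

/-- A double root kills `4I³ − J²`: if `f(u,1) = 0` and `∂f/∂x(u,1) = 0` for a monic depressed `f`,
then `4I(f)³ = J(f)²` (explicit Bézout certificate). [folklore] -/
theorem four_I_cube_sub_J_sq_eq_zero_of_double_root {f : BinaryQuartic K} (ha : f.a = 1)
    (hb : f.b = 0) {u : K} (h0 : f.eval u 1 = 0) (h1 : 4 * u ^ 3 + 2 * f.c * u + f.d = 0) :
    4 * f.I ^ 3 - f.J ^ 2 = 0 := by
  simp only [BinaryQuartic.I, BinaryQuartic.J, eval, ha, hb] at h0 ⊢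
  linear_combination (6912 * u ^ 8 + 13824 * f.c * u ^ 6 + 13824 * f.d * u ^ 5
      + 10368 * f.c ^ 2 * u ^ 4 - 6912 * f.e * u ^ 4 + 13824 * f.c * f.d * u ^ 3
      + 3456 * f.c ^ 3 * u ^ 2 + 6912 * f.d ^ 2 * u ^ 2 - 6912 * f.c * f.e * u ^ 2
      + 3456 * f.c ^ 2 * f.d * u + 432 * f.c ^ 4 - 6912 * f.d * f.e * u + 3888 * f.c * f.d ^ 2
      - 3456 * f.c ^ 2 * f.e + 6912 * f.e ^ 2) * h0
    + (-1728 * u ^ 9 - 4320 * f.c * u ^ 7 - 4752 * f.d * u ^ 6 - 3888 * f.c ^ 2 * u ^ 5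
      - 6912 * f.c * f.d * u ^ 4 - 1512 * f.c ^ 3 * u ^ 3 - 3996 * f.d ^ 2 * u ^ 3
      - 2484 * f.c ^ 2 * f.d * u ^ 2 - 216 * f.c ^ 4 * u - 2430 * f.c * f.d ^ 2 * u
      - 108 * f.c ^ 3 * f.d - 729 * f.d ^ 3) * h1

/-- At a simple root `u` of a monic depressed `f` the point `R = (18u² + 3c, 27f'(u))` lies on
`E'_{I,J}`. [folklore] -/
theorem rootPoint_equation {f : BinaryQuartic K} (ha : f.a = 1) (hb : f.b = 0) {u : K}
    (h0 : f.eval u 1 = 0) :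
    (⟨0, 0, 0, -27 * f.I, -27 * f.J⟩ : WeierstrassCurve K).toAffine.Equation
      (18 * u ^ 2 + 3 * f.c) (27 * (4 * u ^ 3 + 2 * f.c * u + f.d)) := by
  have := descentPoint_equation ha hb (u := u) (v := 0) (by rw [h0]; ring)
  have e1 : (18 : K) * 0 + 18 * u ^ 2 + 3 * f.c = 18 * u ^ 2 + 3 * f.c := by ring
  have e2 : (108 : K) * u * 0 + 108 * u ^ 3 + 54 * f.c * u + 27 * f.d
      = 27 * (4 * u ^ 3 + 2 * f.c * u + f.d) := by ring
  rw [e1, e2] at this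
  exact this

/-! ## The three chord / tangent computations -/

/-- Numeral bookkeeping. [folklore] -/
theorem thirtySix_ne_zero (h2 : (2 : K) ≠ 0) (h3 : (3 : K) ≠ 0) : (36 : K) ≠ 0 := by
  rw [show (36 : K) = 2 * 2 * 3 * 3 by norm_num]
  exact mul_ne_zero (mul_ne_zero (mul_ne_zero h2 h2) h3) h3

/-- **Chord (A): `Θ(u, v) + Θ(u, −v) = −Q'_f`** for `v ≠ 0` — the two points have abscissae
differing by `36v`, the chord has slope `6u` and passes through `Q'_f = (−6c, 27d)`. [folklore] -/
theorem descentPoint_add_conj (h2 : (2 : K) ≠ 0) (h3 : (3 : K) ≠ 0) {I J : K} {f : BinaryQuartic K}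
    {u v : K} (hv0 : v ≠ 0)
    (h₁ : (⟨0, 0, 0, -27 * I, -27 * J⟩ : WeierstrassCurve K).toAffine.Nonsingular
      (18 * v + 18 * u ^ 2 + 3 * f.c) (108 * u * v + 108 * u ^ 3 + 54 * f.c * u + 27 * f.d))
    (h₂ : (⟨0, 0, 0, -27 * I, -27 * J⟩ : WeierstrassCurve K).toAffine.Nonsingular
      (-18 * v + 18 * u ^ 2 + 3 * f.c) (-108 * u * v + 108 * u ^ 3 + 54 * f.c * u + 27 * f.d))
    (h₃ : (⟨0, 0, 0, -27 * I, -27 * J⟩ : WeierstrassCurve K).toAffine.Nonsingular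
      (-6 * f.c) (-27 * f.d)) :
    (.some _ _ h₁ : (⟨0, 0, 0, -27 * I, -27 * J⟩ : WeierstrassCurve K).toAffine.Point)
      + .some _ _ h₂ = .some _ _ h₃ := by
  have hne : (18 * v + 18 * u ^ 2 + 3 * f.c) ≠ (-18 * v + 18 * u ^ 2 + 3 * f.c) := by
    intro h
    have : (36 : K) * v = 0 := by linear_combination h
    exact hv0 ((mul_eq_zero.mp this).resolve_left (thirtySix_ne_zero h2 h3))
  rw [WeierstrassCurve.Affine.Point.add_of_X_ne hne]
  simp only [WeierstrassCurve.Affine.Point.some.injEq]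
  have hs : (⟨0, 0, 0, -27 * I, -27 * J⟩ : WeierstrassCurve K).toAffine.slope
      (18 * v + 18 * u ^ 2 + 3 * f.c) (-18 * v + 18 * u ^ 2 + 3 * f.c)
      (108 * u * v + 108 * u ^ 3 + 54 * f.c * u + 27 * f.d)
      (-108 * u * v + 108 * u ^ 3 + 54 * f.c * u + 27 * f.d) = 6 * u := by
    rw [WeierstrassCurve.Affine.slope_of_X_ne hne, div_eq_iff (sub_ne_zero.mpr hne)]
    ring
  rw [hs]
  refine ⟨?_, ?_⟩
  · simp only [WeierstrassCurve.Affine.addX]; ring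
  · simp only [WeierstrassCurve.Affine.addY, WeierstrassCurve.Affine.negAddY,
      WeierstrassCurve.Affine.addX, WeierstrassCurve.Affine.negY]
    ring

/-- `−Θ(u, −v) = (−18v + 18u² + 3c, 108uv − 108u³ − 54cu − 27d)`. [folklore] -/
theorem neg_descentPoint_conj {I J : K} {f : BinaryQuartic K} {u v : K}
    (h₂ : (⟨0, 0, 0, -27 * I, -27 * J⟩ : WeierstrassCurve K).toAffine.Nonsingular
      (-18 * v + 18 * u ^ 2 + 3 * f.c) (-108 * u * v + 108 * u ^ 3 + 54 * f.c * u + 27 * f.d))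
    (h₂' : (⟨0, 0, 0, -27 * I, -27 * J⟩ : WeierstrassCurve K).toAffine.Nonsingular
      (-18 * v + 18 * u ^ 2 + 3 * f.c) (108 * u * v - 108 * u ^ 3 - 54 * f.c * u - 27 * f.d)) :
    -(.some _ _ h₂ : (⟨0, 0, 0, -27 * I, -27 * J⟩ : WeierstrassCurve K).toAffine.Point)
      = .some _ _ h₂' := by
  rw [WeierstrassCurve.Affine.Point.neg_some]
  congr 1
  rw [cremona_negY]; ring

/-- **Chord (B): `Θ(u, v) − Θ(u, −v) = (3g₄(u,1)/(4v²), 27g₆(u,1)/(8v³))`, the covering image of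
`(u : 1 : v)`**, for `v ≠ 0` and `v² = f(u,1)` (`f` monic depressed): the chord through `Θ(u,v)`
and `−Θ(u,−v)` has slope `3f'(u)/(2v)`; the abscissa of the sum is `g₄ = 3f'² − 4ff''` over `4v²`
and the ordinate `27g₆ = 54ff'f'' − 27f'³ − 36f²f'''` over `8v³`. The target coordinates are
given through `4v²X₃ = 3g₄(u,1)`, `8v³Y₃ = 27g₆(u,1)`. [cite: Cremona2001, Prop. 4.3 (4)] -/
theorem descentPoint_add_neg_conj (h2 : (2 : K) ≠ 0) (h3 : (3 : K) ≠ 0) {I J : K}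
    {f : BinaryQuartic K} (ha : f.a = 1) (hb : f.b = 0) {u v X₃ Y₃ : K} (hv : v ^ 2 = f.eval u 1)
    (hv0 : v ≠ 0) (hX : 4 * v ^ 2 * X₃ = 3 * (g4 f).eval u 1) (hY : 8 * v ^ 3 * Y₃ = 27 * f.g6 u 1)
    (h₁ : (⟨0, 0, 0, -27 * I, -27 * J⟩ : WeierstrassCurve K).toAffine.Nonsingular
      (18 * v + 18 * u ^ 2 + 3 * f.c) (108 * u * v + 108 * u ^ 3 + 54 * f.c * u + 27 * f.d))
    (h₂' : (⟨0, 0, 0, -27 * I, -27 * J⟩ : WeierstrassCurve K).toAffine.Nonsingular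
      (-18 * v + 18 * u ^ 2 + 3 * f.c) (108 * u * v - 108 * u ^ 3 - 54 * f.c * u - 27 * f.d))
    (h₃ : (⟨0, 0, 0, -27 * I, -27 * J⟩ : WeierstrassCurve K).toAffine.Nonsingular X₃ Y₃) :
    (.some _ _ h₁ : (⟨0, 0, 0, -27 * I, -27 * J⟩ : WeierstrassCurve K).toAffine.Point)
      + .some _ _ h₂' = .some _ _ h₃ := by
  have hne : (18 * v + 18 * u ^ 2 + 3 * f.c) ≠ (-18 * v + 18 * u ^ 2 + 3 * f.c) := by
    intro h
    have : (36 : K) * v = 0 := by linear_combination h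
    exact hv0 ((mul_eq_zero.mp this).resolve_left (thirtySix_ne_zero h2 h3))
  rw [WeierstrassCurve.Affine.Point.add_of_X_ne hne]
  simp only [WeierstrassCurve.Affine.Point.some.injEq]
  set ℓ := (⟨0, 0, 0, -27 * I, -27 * J⟩ : WeierstrassCurve K).toAffine.slope
      (18 * v + 18 * u ^ 2 + 3 * f.c) (-18 * v + 18 * u ^ 2 + 3 * f.c)
      (108 * u * v + 108 * u ^ 3 + 54 * f.c * u + 27 * f.d)
      (108 * u * v - 108 * u ^ 3 - 54 * f.c * u - 27 * f.d) with hℓdef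
  -- the slope: `2vℓ = 3 f'(u)`
  have hℓ : ℓ * (2 * v) = 3 * (4 * u ^ 3 + 2 * f.c * u + f.d) := by
    have h18 : (18 : K) ≠ 0 := by
      rw [show (18 : K) = 2 * 3 * 3 by norm_num]; exact mul_ne_zero (mul_ne_zero h2 h3) h3
    have := WeierstrassCurve.Affine.slope_of_X_ne
      (W := (⟨0, 0, 0, -27 * I, -27 * J⟩ : WeierstrassCurve K))
      (y₁ := 108 * u * v + 108 * u ^ 3 + 54 * f.c * u + 27 * f.d)
      (y₂ := 108 * u * v - 108 * u ^ 3 - 54 * f.c * u - 27 * f.d) hne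
    rw [← hℓdef, eq_div_iff (sub_ne_zero.mpr hne)] at this
    apply mul_left_cancel₀ h18
    linear_combination this
  simp only [eval, ha, hb] at hv
  simp only [g4, eval, ha, hb] at hX
  simp only [g6, ha, hb] at hY
  have h4v : 4 * v ^ 2 ≠ 0 := mul_ne_zero (by
    rw [show (4 : K) = 2 * 2 by norm_num]; exact mul_ne_zero h2 h2) (pow_ne_zero _ hv0)
  have h8v : 8 * v ^ 3 ≠ 0 := mul_ne_zero (by
    rw [show (8 : K) = 2 * 2 * 2 by norm_num]; exact mul_ne_zero (mul_ne_zero h2 h2) h2)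
    (pow_ne_zero _ hv0)
  have hx : (⟨0, 0, 0, -27 * I, -27 * J⟩ : WeierstrassCurve K).toAffine.addX
      (18 * v + 18 * u ^ 2 + 3 * f.c) (-18 * v + 18 * u ^ 2 + 3 * f.c) ℓ = X₃ := by
    simp only [WeierstrassCurve.Affine.addX]
    apply mul_left_cancel₀ h4v
    rw [hX]
    linear_combination (ℓ * (2 * v) + 3 * (4 * u ^ 3 + 2 * f.c * u + f.d)) * hℓ
      + (-144 * u ^ 2 - 24 * f.c) * hv
  refine ⟨hx, ?_⟩
  simp only [WeierstrassCurve.Affine.addY, WeierstrassCurve.Affine.negAddY,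
    WeierstrassCurve.Affine.negY]
  rw [hx]
  apply mul_left_cancel₀ h8v
  rw [show 8 * v ^ 3 * (-(ℓ * (X₃ - (18 * v + 18 * u ^ 2 + 3 * f.c))
      + (108 * u * v + 108 * u ^ 3 + 54 * f.c * u + 27 * f.d)) - 0 * X₃ - 0)
      = -(2 * v * ℓ) * (4 * v ^ 2 * X₃) + 4 * v ^ 2 * (2 * v * ℓ) * (18 * v + 18 * u ^ 2 + 3 * f.c)
        - 8 * v ^ 3 * (108 * u * v + 108 * u ^ 3 + 54 * f.c * u + 27 * f.d) by ring]
  rw [hX, hY, show 2 * v * ℓ = ℓ * (2 * v) by ring, hℓ]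
  linear_combination (-288 * f.c * u ^ 3 - 864 * u * v ^ 2 - 648 * f.d * u ^ 2
    + 72 * f.c ^ 2 * u - 864 * f.e * u + 36 * f.c * f.d) * hv

/-- **Tangent (root case): `2 · (18u² + 3c, 27f'(u)) = −Q'_f`** at a simple root `u` of
`f(·, 1)` (`f` monic depressed, `f'(u) ≠ 0`): the tangent has slope `6u`. This is the statement
"a quartic with a `K`-rational linear factor has `Q' ∈ 2E(K)`" (cf. `BhargavaShankarTrivialClass`
in characteristic `0`). [cite: Cremona2001, Prop. 4.3 (4)] -/
theorem rootPoint_add_self (h2 : (2 : K) ≠ 0) (h3 : (3 : K) ≠ 0) {I J : K} {f : BinaryQuartic K}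
    (ha : f.a = 1) (hb : f.b = 0) (hI : f.I = I) {u : K} (h0 : f.eval u 1 = 0)
    (h1 : 4 * u ^ 3 + 2 * f.c * u + f.d ≠ 0)
    (hR : (⟨0, 0, 0, -27 * I, -27 * J⟩ : WeierstrassCurve K).toAffine.Nonsingular
      (18 * u ^ 2 + 3 * f.c) (27 * (4 * u ^ 3 + 2 * f.c * u + f.d)))
    (h₃ : (⟨0, 0, 0, -27 * I, -27 * J⟩ : WeierstrassCurve K).toAffine.Nonsingular
      (-6 * f.c) (-27 * f.d)) :
    (.some _ _ hR : (⟨0, 0, 0, -27 * I, -27 * J⟩ : WeierstrassCurve K).toAffine.Point)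
      + .some _ _ hR = .some _ _ h₃ := by
  have h27 : (27 : K) ≠ 0 := by
    rw [show (27 : K) = 3 * 3 * 3 by norm_num]; exact mul_ne_zero (mul_ne_zero h3 h3) h3
  have hy0 : (27 : K) * (4 * u ^ 3 + 2 * f.c * u + f.d) ≠ 0 := mul_ne_zero h27 h1
  have hy : 27 * (4 * u ^ 3 + 2 * f.c * u + f.d) ≠
      (⟨0, 0, 0, -27 * I, -27 * J⟩ : WeierstrassCurve K).toAffine.negY (18 * u ^ 2 + 3 * f.c)
        (27 * (4 * u ^ 3 + 2 * f.c * u + f.d)) := by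
    rw [cremona_negY]
    intro h
    have : (2 : K) * (27 * (4 * u ^ 3 + 2 * f.c * u + f.d)) = 0 := by linear_combination h
    exact hy0 ((mul_eq_zero.mp this).resolve_left h2)
  have hden : 27 * (4 * u ^ 3 + 2 * f.c * u + f.d) -
      (⟨0, 0, 0, -27 * I, -27 * J⟩ : WeierstrassCurve K).toAffine.negY (18 * u ^ 2 + 3 * f.c)
        (27 * (4 * u ^ 3 + 2 * f.c * u + f.d)) = 2 * (27 * (4 * u ^ 3 + 2 * f.c * u + f.d)) := by
    rw [cremona_negY]; ring
  have hs : (⟨0, 0, 0, -27 * I, -27 * J⟩ : WeierstrassCurve K).toAffine.slope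
      (18 * u ^ 2 + 3 * f.c) (18 * u ^ 2 + 3 * f.c) (27 * (4 * u ^ 3 + 2 * f.c * u + f.d))
      (27 * (4 * u ^ 3 + 2 * f.c * u + f.d)) = 6 * u := by
    rw [WeierstrassCurve.Affine.slope_of_Y_ne rfl hy, hden, div_eq_iff (mul_ne_zero h2 hy0), ← hI]
    simp only [BinaryQuartic.I, BinaryQuartic.eval, ha, hb] at h0 ⊢
    linear_combination (-324) * h0
  rw [WeierstrassCurve.Affine.Point.add_self_of_Y_ne hy]
  simp only [WeierstrassCurve.Affine.Point.some.injEq]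
  rw [hs]
  refine ⟨?_, ?_⟩
  · simp only [WeierstrassCurve.Affine.addX]; ring
  · simp only [WeierstrassCurve.Affine.addY, WeierstrassCurve.Affine.negAddY,
      WeierstrassCurve.Affine.addX, WeierstrassCurve.Affine.negY]
    ring

/-! ## Consequences for the twisted action -/

/-- If `γ · f = f'` with `f'` monic then `(det γ)² = f(γ₀₀, γ₀₁)`: the base point `(1 : 0 : 1)` of
`C_{f'}` comes from the point `(γ₀₀ : γ₀₁ : det γ)` of `C_f`. [folklore] -/
theorem det_sq_eq_eval_of_twist_a_eq_one {γ : Matrix (Fin 2) (Fin 2) K} (hγ : γ.det ≠ 0)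
    {f : BinaryQuartic K} (h : (twist γ f).a = 1) : γ.det ^ 2 = f.eval (γ 0 0) (γ 0 1) := by
  have := twist_a_eq γ f
  rw [h] at this
  have h2 : γ.det ^ 2 ≠ 0 := pow_ne_zero _ hγ
  field_simp at this
  linear_combination this

/-- If `γ · f` has `a = 0` then `f(γ₀₀, γ₀₁) = 0`: `f` vanishes at the nonzero vector `(γ₀₀, γ₀₁)`.
[folklore] -/
theorem eval_eq_zero_of_twist_a_eq_zero {γ : Matrix (Fin 2) (Fin 2) K} (hγ : γ.det ≠ 0)
    {f : BinaryQuartic K} (h : (twist γ f).a = 0) : f.eval (γ 0 0) (γ 0 1) = 0 := by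
  have := twist_a_eq γ f
  rw [h] at this
  have h2 : (γ.det ^ 2)⁻¹ ≠ 0 := inv_ne_zero (pow_ne_zero _ hγ)
  exact (mul_eq_zero.mp this.symm).resolve_left h2

/-- `−Q'_f = (−6c, −27d)`. [folklore] -/
theorem neg_basePoint {I J : K} {f : BinaryQuartic K}
    (h₀ : (⟨0, 0, 0, -27 * I, -27 * J⟩ : WeierstrassCurve K).toAffine.Nonsingular
      (-6 * f.c) (27 * f.d))
    (h₃ : (⟨0, 0, 0, -27 * I, -27 * J⟩ : WeierstrassCurve K).toAffine.Nonsingular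
      (-6 * f.c) (-27 * f.d)) :
    -(.some _ _ h₀ : (⟨0, 0, 0, -27 * I, -27 * J⟩ : WeierstrassCurve K).toAffine.Point)
      = .some _ _ h₃ := by
  rw [WeierstrassCurve.Affine.Point.neg_some]
  congr 1
  rw [cremona_negY]; ring

/-- **Injectivity of the descent map on monic depressed forms (Bhargava–Shankar, Lemma 5.10;
Cremona 2001, Prop. 4.3 (4)), over any field with `2 ≠ 0`, `3 ≠ 0`.** If `f`, `f'` are monic
depressed quartics with invariants `(I, J)`, `4I³ ≠ J²`, in the same class for the twisted action
(`γ · f = f'`), then `Q'_{f'} − Q'_f ∈ 2E'_{I,J}(K)`. Proof: `Q'_{f'}` is the covering image of the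
point `(γ₀₀ : γ₀₁ : det γ)` of `C_f`; if `γ₀₁ ≠ 0` this is `Q'_f + 2Θ` by the chords (A), (B); if
`γ₀₁ = 0` it is `±Q'_f`. [cite: BhargavaShankarAnnals2015, Lemma 5.10 (arXiv:1006.1002v2 numbering)] -/
theorem exists_basePoint_sub_eq_add_self (h2 : (2 : K) ≠ 0) (h3 : (3 : K) ≠ 0) {I J : K}
    (hIJ : 4 * I ^ 3 - J ^ 2 ≠ 0) {f f' : BinaryQuartic K} (ha : f.a = 1) (hb : f.b = 0)
    (ha' : f'.a = 1) (hb' : f'.b = 0) (hI : f.I = I) (hJ : f.J = J)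
    {γ : Matrix (Fin 2) (Fin 2) K} (hγ : γ.det ≠ 0) (hff' : twist γ f = f')
    (h₀ : (⟨0, 0, 0, -27 * I, -27 * J⟩ : WeierstrassCurve K).toAffine.Nonsingular
      (-6 * f.c) (27 * f.d))
    (h₀' : (⟨0, 0, 0, -27 * I, -27 * J⟩ : WeierstrassCurve K).toAffine.Nonsingular
      (-6 * f'.c) (27 * f'.d)) :
    ∃ R : (⟨0, 0, 0, -27 * I, -27 * J⟩ : WeierstrassCurve K).toAffine.Point,
      (.some _ _ h₀' : (⟨0, 0, 0, -27 * I, -27 * J⟩ : WeierstrassCurve K).toAffine.Point)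
        - .some _ _ h₀ = R + R := by
  have h4 : (4 : K) ≠ 0 := by rw [show (4 : K) = 2 * 2 by norm_num]; exact mul_ne_zero h2 h2
  have h8 : (8 : K) ≠ 0 := by rw [show (8 : K) = 2 * 4 by norm_num]; exact mul_ne_zero h2 h4
  have h6 : (6 : K) ≠ 0 := by rw [show (6 : K) = 2 * 3 by norm_num]; exact mul_ne_zero h2 h3
  have h27 : (27 : K) ≠ 0 := by
    rw [show (27 : K) = 3 * 3 * 3 by norm_num]; exact mul_ne_zero (mul_ne_zero h3 h3) h3
  have hdet : γ.det ^ 2 = f.eval (γ 0 0) (γ 0 1) :=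
    det_sq_eq_eval_of_twist_a_eq_one hγ (by rw [hff', ha'])
  -- the coordinates of `Q'_{f'}` are the covering image of `(γ₀₀ : γ₀₁ : det γ) ∈ C_f`
  have hXc : -6 * f'.c = 3 * (g4 f).eval (γ 0 0) (γ 0 1) / (4 * γ.det ^ 2) := by
    rw [← coveringX'_base ha' hb' h2, ← hff', coveringX'_twist_base hγ]
  have hYc : 27 * f'.d = 27 * f.g6 (γ 0 0) (γ 0 1) / (8 * γ.det ^ 3) := by
    rw [← coveringY'_base ha' hb' h2, ← hff', coveringY'_twist_base hγ]
  -- `-Q'_f`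
  have h₃ : (⟨0, 0, 0, -27 * I, -27 * J⟩ : WeierstrassCurve K).toAffine.Nonsingular
      (-6 * f.c) (-27 * f.d) := by
    have := (WeierstrassCurve.Affine.nonsingular_neg (-6 * f.c) (27 * f.d)).mpr h₀
    rwa [cremona_negY, ← neg_mul] at this
  have hQneg := neg_basePoint h₀ h₃
  by_cases h01 : γ 0 1 = 0
  · -- `γ₀₁ = 0`: `Q'_{f'} = ± Q'_f`
    have hdet' : γ.det = γ 0 0 * γ 1 1 := by rw [Matrix.det_fin_two, h01]; ring
    have h00 : γ 0 0 ≠ 0 := fun h ↦ hγ (by rw [hdet', h, zero_mul])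
    have hdet2 : γ.det ^ 2 = (γ 0 0) ^ 4 := by
      rw [hdet, h01]; simp only [BinaryQuartic.eval, ha]; ring
    have hsq : (γ 1 1 - γ 0 0) * (γ 1 1 + γ 0 0) = 0 := by
      have h' : (γ 0 0) ^ 2 * ((γ 1 1 - γ 0 0) * (γ 1 1 + γ 0 0)) = 0 := by
        rw [hdet'] at hdet2; linear_combination hdet2
      exact (mul_eq_zero.mp h').resolve_left (pow_ne_zero _ h00)
    have hg4 : (g4 f).eval (γ 0 0) 0 = -8 * f.c * (γ 0 0) ^ 4 := by
      simp only [g4, BinaryQuartic.eval, ha, hb]; ring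
    have hg6 : f.g6 (γ 0 0) 0 = 8 * f.d * (γ 0 0) ^ 6 := by
      simp only [g6, ha, hb]; ring
    have hc' : f'.c = f.c := by
      rw [h01, hg4, hdet2] at hXc
      have h4g : (4 : K) * (γ 0 0) ^ 4 ≠ 0 := mul_ne_zero h4 (pow_ne_zero _ h00)
      rw [eq_div_iff h4g] at hXc
      have : (24 * (γ 0 0) ^ 4) * (f'.c - f.c) = 0 := by linear_combination -hXc
      have h24 : (24 : K) * (γ 0 0) ^ 4 ≠ 0 :=
        mul_ne_zero (by rw [show (24 : K) = 4 * 6 by norm_num]; exact mul_ne_zero h4 h6)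
          (pow_ne_zero _ h00)
      exact sub_eq_zero.mp ((mul_eq_zero.mp this).resolve_left h24)
    rw [h01, hg6, hdet'] at hYc
    rcases mul_eq_zero.mp hsq with h11 | h11
    · -- `γ₁₁ = γ₀₀`: `Q'_{f'} = Q'_f`
      have h11' : γ 1 1 = γ 0 0 := sub_eq_zero.mp h11
      have hd' : f'.d = f.d := by
        rw [h11'] at hYc
        have h8g : (8 : K) * (γ 0 0 * γ 0 0) ^ 3 ≠ 0 :=
          mul_ne_zero h8 (pow_ne_zero _ (mul_ne_zero h00 h00))
        rw [eq_div_iff h8g] at hYc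
        have : (216 * (γ 0 0) ^ 6) * (f'.d - f.d) = 0 := by linear_combination hYc
        have h216 : (216 : K) * (γ 0 0) ^ 6 ≠ 0 :=
          mul_ne_zero (by rw [show (216 : K) = 8 * 27 by norm_num]; exact mul_ne_zero h8 h27)
            (pow_ne_zero _ h00)
        exact sub_eq_zero.mp ((mul_eq_zero.mp this).resolve_left h216)
      refine ⟨0, ?_⟩
      rw [add_zero, sub_eq_zero]
      simp only [WeierstrassCurve.Affine.Point.some.injEq]
      exact ⟨by rw [hc'], by rw [hd']⟩
    · -- `γ₁₁ = -γ₀₀`: `Q'_{f'} = -Q'_f`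
      have h11' : γ 1 1 = -γ 0 0 := eq_neg_of_add_eq_zero_left h11
      have hd' : f'.d = -f.d := by
        rw [h11'] at hYc
        have h8g : (8 : K) * (γ 0 0 * -γ 0 0) ^ 3 ≠ 0 :=
          mul_ne_zero h8 (pow_ne_zero _ (mul_ne_zero h00 (neg_ne_zero.mpr h00)))
        rw [eq_div_iff h8g] at hYc
        have : (216 * (γ 0 0) ^ 6) * (f'.d + f.d) = 0 := by linear_combination -hYc
        have h216 : (216 : K) * (γ 0 0) ^ 6 ≠ 0 :=
          mul_ne_zero (by rw [show (216 : K) = 8 * 27 by norm_num]; exact mul_ne_zero h8 h27)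
            (pow_ne_zero _ h00)
        exact eq_neg_of_add_eq_zero_left ((mul_eq_zero.mp this).resolve_left h216)
      refine ⟨-(.some _ _ h₀), ?_⟩
      have hP' : (.some _ _ h₀' : (⟨0, 0, 0, -27 * I, -27 * J⟩ : WeierstrassCurve K).toAffine.Point)
          = .some _ _ h₃ := by
        simp only [WeierstrassCurve.Affine.Point.some.injEq]
        exact ⟨by rw [hc'], by rw [hd']; ring⟩
      rw [hP', ← hQneg, sub_eq_add_neg]
  · -- `γ₀₁ ≠ 0`: scale to the chart `y = 1`
    set t := γ 0 1 with ht
    set u := γ 0 0 / t with hu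
    set v := γ.det / t ^ 2 with hvdef
    have htu : t * u = γ 0 0 := by rw [hu]; field_simp
    have htv : t ^ 2 * v = γ.det := by rw [hvdef]; field_simp
    have hv0 : v ≠ 0 := div_ne_zero hγ (pow_ne_zero _ h01)
    have hev : f.eval (γ 0 0) (γ 0 1) = t ^ 4 * f.eval u 1 := by
      rw [← eval_smul_smul, htu, mul_one]
    have hv : v ^ 2 = f.eval u 1 := by
      have h' : (t ^ 2 * v) ^ 2 = t ^ 4 * f.eval u 1 := by rw [htv, hdet, hev]
      have ht4 : t ^ 4 ≠ 0 := pow_ne_zero _ h01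
      apply mul_left_cancel₀ ht4
      linear_combination h'
    have hv' : (-v) ^ 2 = f.eval u 1 := by rw [neg_sq, hv]
    -- covering coordinates of `(u : 1 : v)`
    have hXc' : -6 * f'.c = 3 * (g4 f).eval u 1 / (4 * v ^ 2) := by
      rw [hXc, ← coveringX'_smul f h01 u 1 v, htu, mul_one, htv]
    have hYc' : 27 * f'.d = 27 * f.g6 u 1 / (8 * v ^ 3) := by
      rw [hYc, ← coveringY'_smul f h01 u 1 v, htu, mul_one, htv]
    have hX3 : 4 * v ^ 2 * (-6 * f'.c) = 3 * (g4 f).eval u 1 := by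
      rw [hXc']; field_simp
    have hY3 : 8 * v ^ 3 * (27 * f'.d) = 27 * f.g6 u 1 := by
      rw [hYc']; field_simp
    -- the descent points
    have hfI : (⟨0, 0, 0, -27 * f.I, -27 * f.J⟩ : WeierstrassCurve K) = ⟨0, 0, 0, -27 * I, -27 * J⟩ := by
      rw [hI, hJ]
    have h₁ : (⟨0, 0, 0, -27 * I, -27 * J⟩ : WeierstrassCurve K).toAffine.Nonsingular
        (18 * v + 18 * u ^ 2 + 3 * f.c) (108 * u * v + 108 * u ^ 3 + 54 * f.c * u + 27 * f.d) :=
      cremona_nonsingular h2 h3 hIJ (hfI ▸ descentPoint_equation ha hb hv)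
    have h₂ : (⟨0, 0, 0, -27 * I, -27 * J⟩ : WeierstrassCurve K).toAffine.Nonsingular
        (18 * -v + 18 * u ^ 2 + 3 * f.c)
        (108 * u * -v + 108 * u ^ 3 + 54 * f.c * u + 27 * f.d) :=
      cremona_nonsingular h2 h3 hIJ (hfI ▸ descentPoint_equation ha hb hv')
    have h₂n : (⟨0, 0, 0, -27 * I, -27 * J⟩ : WeierstrassCurve K).toAffine.Nonsingular
        (-18 * v + 18 * u ^ 2 + 3 * f.c)
        (-108 * u * v + 108 * u ^ 3 + 54 * f.c * u + 27 * f.d) := by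
      have e1 : (18 * -v + 18 * u ^ 2 + 3 * f.c) = -18 * v + 18 * u ^ 2 + 3 * f.c := by ring
      have e2 : (108 * u * -v + 108 * u ^ 3 + 54 * f.c * u + 27 * f.d)
          = -108 * u * v + 108 * u ^ 3 + 54 * f.c * u + 27 * f.d := by ring
      rw [e1, e2] at h₂; exact h₂
    have h₂' : (⟨0, 0, 0, -27 * I, -27 * J⟩ : WeierstrassCurve K).toAffine.Nonsingular
        (-18 * v + 18 * u ^ 2 + 3 * f.c)
        (108 * u * v - 108 * u ^ 3 - 54 * f.c * u - 27 * f.d) := by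
      have := (WeierstrassCurve.Affine.nonsingular_neg (-18 * v + 18 * u ^ 2 + 3 * f.c)
        (-108 * u * v + 108 * u ^ 3 + 54 * f.c * u + 27 * f.d)).mpr h₂n
      rw [cremona_negY] at this
      have e2 : -(-108 * u * v + 108 * u ^ 3 + 54 * f.c * u + 27 * f.d)
          = 108 * u * v - 108 * u ^ 3 - 54 * f.c * u - 27 * f.d := by ring
      rw [e2] at this; exact this
    have hA := descentPoint_add_conj (f := f) h2 h3 hv0 h₁ h₂n h₃
    have hB := descentPoint_add_neg_conj h2 h3 ha hb hv hv0 hX3 hY3 h₁ h₂' h₀'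
    have hneg := neg_descentPoint_conj h₂n h₂'
    refine ⟨.some _ _ h₁, ?_⟩
    have key : (.some _ _ h₀ : (⟨0, 0, 0, -27 * I, -27 * J⟩ : WeierstrassCurve K).toAffine.Point)
        = -((.some _ _ h₁) + (.some _ _ h₂n)) := by
      rw [hA, ← hQneg, neg_neg]
    rw [← hB, ← hneg, key]
    abel

/-- **The class of `y · (cubic)` (Bhargava–Shankar's `f_O`; Cremona 2001, Prop. 4.3 (4)):** if a
monic depressed `f` with invariants `(I, J)`, `4I³ ≠ J²`, is carried by the twisted action to a form
with `a = 0` — equivalently, `f` has a `K`-rational zero in `ℙ¹` — then `Q'_f ∈ 2E'_{I,J}(K)`: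
the zero `(γ₀₀ : γ₀₁)` has `γ₀₁ ≠ 0`, `u = γ₀₀/γ₀₁` is a simple root of `f(·,1)`, and
`Q'_f = 2 · (−R)` for `R = (18u² + 3c, 27f'(u))`. [cite: BhargavaShankarAnnals2015, Lemma 5.10 (arXiv:1006.1002v2 numbering)] -/
theorem exists_basePoint_eq_add_self_of_twist_a_eq_zero (h2 : (2 : K) ≠ 0) (h3 : (3 : K) ≠ 0)
    {I J : K} (hIJ : 4 * I ^ 3 - J ^ 2 ≠ 0) {f : BinaryQuartic K} (ha : f.a = 1) (hb : f.b = 0)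
    (hI : f.I = I) (hJ : f.J = J) {γ : Matrix (Fin 2) (Fin 2) K} (hγ : γ.det ≠ 0)
    (h0 : (twist γ f).a = 0)
    (h₀ : (⟨0, 0, 0, -27 * I, -27 * J⟩ : WeierstrassCurve K).toAffine.Nonsingular
      (-6 * f.c) (27 * f.d)) :
    ∃ R : (⟨0, 0, 0, -27 * I, -27 * J⟩ : WeierstrassCurve K).toAffine.Point,
      (.some _ _ h₀ : (⟨0, 0, 0, -27 * I, -27 * J⟩ : WeierstrassCurve K).toAffine.Point)
        = R + R := by
  have hev : f.eval (γ 0 0) (γ 0 1) = 0 := eval_eq_zero_of_twist_a_eq_zero hγ h0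
  have h01 : γ 0 1 ≠ 0 := by
    intro h01
    rw [h01] at hev
    simp only [BinaryQuartic.eval, ha] at hev
    have h00 : γ 0 0 = 0 := by
      have : (γ 0 0) ^ 4 = 0 := by linear_combination hev
      exact pow_eq_zero_iff (by norm_num) |>.mp this
    apply hγ
    rw [Matrix.det_fin_two, h01, h00]; ring
  set t := γ 0 1 with ht
  set u := γ 0 0 / t with hu
  have htu : t * u = γ 0 0 := by rw [hu]; field_simp
  have hroot : f.eval u 1 = 0 := by
    have hev' : f.eval (γ 0 0) (γ 0 1) = t ^ 4 * f.eval u 1 := by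
      rw [← eval_smul_smul, htu, mul_one]
    rw [hev'] at hev
    exact (mul_eq_zero.mp hev).resolve_left (pow_ne_zero _ h01)
  have hfu : 4 * u ^ 3 + 2 * f.c * u + f.d ≠ 0 := fun h1 ↦
    hIJ (by rw [← hI, ← hJ]; exact four_I_cube_sub_J_sq_eq_zero_of_double_root ha hb hroot h1)
  have hfI : (⟨0, 0, 0, -27 * f.I, -27 * f.J⟩ : WeierstrassCurve K) = ⟨0, 0, 0, -27 * I, -27 * J⟩ := by
    rw [hI, hJ]
  have hR : (⟨0, 0, 0, -27 * I, -27 * J⟩ : WeierstrassCurve K).toAffine.Nonsingular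
      (18 * u ^ 2 + 3 * f.c) (27 * (4 * u ^ 3 + 2 * f.c * u + f.d)) :=
    cremona_nonsingular h2 h3 hIJ (hfI ▸ rootPoint_equation ha hb hroot)
  have h₃ : (⟨0, 0, 0, -27 * I, -27 * J⟩ : WeierstrassCurve K).toAffine.Nonsingular
      (-6 * f.c) (-27 * f.d) := by
    have := (WeierstrassCurve.Affine.nonsingular_neg (-6 * f.c) (27 * f.d)).mpr h₀
    rwa [cremona_negY, ← neg_mul] at this
  have h2R := rootPoint_add_self (J := J) h2 h3 ha hb hI hroot hfu hR h₃
  have hQneg := neg_basePoint h₀ h₃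
  refine ⟨-(.some _ _ hR), ?_⟩
  rw [← neg_add, h2R, ← hQneg, neg_neg]

end BinaryQuartic

end Literature.NumberTheory.EllipticCurves

end
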